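import Literature.AlgebraicGeometry.Resolution.CoefficientIdealRestriction
import Literature.AlgebraicGeometry.Resolution.DerivativeIdealsChart
import HarnessLib

/-!
# A transverse derivation along a blow-up chart (BGMW 2011, Lemma 3.9.4 (2); [Wlod] Lemma 3.10.4) — ring level

Topic: `Literature/AlgebraicGeometry/Resolution`. Layer of the decomposition of the named facts
`BierstoneGrigorievMilmanWlodarczyk2011_marked` / `_canonical` (Bierstone–Grigoriev–Milman–
Włodarczyk, arXiv:1206.3090, Thm. 8.0.5). The persistence clause (2) of Lemma 3.9.4,
"`supp(𝓘_i, μ) ∩ S_i = supp[𝒞(𝓘, μ)|_S]_i`" along a multiple blow-up with centres in the strict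
transforms `S_i` of the hypersurface `S`, is proved in [Wlod] (Włodarczyk, *Simple Hironaka
resolution in characteristic zero*, Lemma 3.10.4) by carrying along the blow-ups the invariant

  "`f_k = Σ c_{α f k}(y) x^α`, where `c_{α f k}|_{S_k} ∈ (σ^k|_{S_k})ᶜ(𝒟^{|α|}(𝓘)|_S)`"

for the controlled transforms `f_k` of the elements `f ∈ 𝓘`, in formal coordinates `(x, y)` with
`S = {x = 0}`, using `c'_{α f} = y_m^{-μ+|α|} σ^*(c_{α f})` on the `y_m`-chart. This file renders
that invariant and its propagation WITHOUT completions, for a hypersurface `S = V(u)`, replacing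
the formal coefficients `c_{α f}` (`= (1/α!) ∂^α f/∂x^α` on `S`) by the iterated derivatives
`δ^j f` along ONE derivation `δ` transverse to `u` (as in `CoefficientIdealRestriction.lean`,
where the first claim of Lemma 3.9.4 is proved this way). The invariant, for a marked ideal
`(J, μ)` and a family of ideals `K_0, K_1, …` (initially `K_i = 𝒟ⁱ(J)`):

  (T) `δ^j f ∈ K_0 + K_1 + ⋯ + K_j` for all `f ∈ J` and `j < μ`.

On an abstract chart of the blow-up along `I ∋ a` — an `R`-algebra `S` in which `a` is a
non-zero-divisor and `a·δ` extends to a derivation `D` with `D(r) = a·δ(r)` (the affine blowup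
algebra `R[I/a]`, `AffineBlowupAlgebra.lean`, `exists_derivation_blowupAlgebra`) — with the
controlled transforms `J' = (J S : a^μ)`, `K_i' = (K_i S : a^{μ-i})` (divisibility
`J S ⊆ (a^μ)`, `K_i S ⊆ (a^{μ-i})` being BGMW Lemma 3.2.1 for an admissible centre), PROVED:

* `pow_mul_transformDeriv_eq` — **the derivative of a controlled transform**: if
  `a^{m+1} g' = g` in `S` then `a^m · (D g' + (m+1) δ(a) g') = δ(g)`, i.e.
  `D(σᶜ(g, m+1)) = σᶜ(δ g, m) − (m+1)·δ(a)·σᶜ(g, m+1)` ([Wlod]: `c' = y^{-μ+|α|} σ^* c`);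
* `apply_transform_sub_mem_span` — in particular `D(u') ≡ δ(u) (mod u')` for the strict
  transform `u' = u/a` of the hypersurface: **`D` is again transverse to `V(u')`**
  (`isUnit_mk_apply_transform`), and `(u S : a) = (u')` (`colon_span_singleton_eq_span_of_mul_eq`);
* `Derivation.forall_iterate_mul_mem` — for a monotone family of ideals `F`, the condition
  "`D^l h ∈ F_l` for all `l ≤ n`" is stable under multiplication by ring elements (Leibniz);
* **`forall_iterate_transform_mem_iSup_colon`** — **(T) passes to the chart**: if (T) holds for
  `(J, μ, K, δ)` on `R`, then `D^j f' ∈ K_0' + ⋯ + K_j'` for all `f' ∈ J'` and `j < μ`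
  (for a generator `f' = f/a^μ`: `D^j f'` is an `S`-combination of the transforms
  `t_i = δ^i(f)/a^{μ-i} ∈ K_0' + ⋯ + K_i'`, `i ≤ j`, since `D t_i = t_{i+1} − (μ−i) δ(a) t_i`).

Characteristic-free (no division by integers). The sheaf-level assembly (Lemma 3.9.4 (2) for
`IsBlowup`, iterated along `IsMultipleBlowup`) is not in this file.

## Sources

* E. Bierstone, D. Grigoriev, P. Milman, J. Włodarczyk, arXiv:1206.3090 (arXiv numbering):
  Lemma 3.9.4 and its proof (p. 10), §3.2 (p. 6). [BierstoneGrigorievMilmanWlodarczyk2011]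
* J. Włodarczyk, *Simple Hironaka resolution in characteristic zero*, J. AMS 18 (2005),
  Lemma 3.10.4 and its proof (arXiv:math/0401401 numbering, pp. 13–14). [Wlodarczyk2005]
-/

noncomputable section

namespace Literature.AlgebraicGeometry.Resolution

universe u v w

section Chart

variable {k : Type u} [CommRing k] {R : Type v} {S : Type w} [CommRing R] [CommRing S]
  [Algebra k R] [Algebra k S] [Algebra R S]

/-! ## Colon ideals by a principal ideal -/

/-- `(x) · (N : x) = N` whenever `N ⊆ (x)`. [folklore] -/
theorem Ideal.span_singleton_mul_colon_eq_of_le {x : S} {N : Ideal S} (hN : N ≤ Ideal.span {x}) :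
    Ideal.span {x} * N.colon {x} = N := by
  apply le_antisymm
  · rw [Ideal.mul_le]
    intro r hr s hs
    obtain ⟨c, rfl⟩ := Ideal.mem_span_singleton'.mp hr
    rw [Submodule.mem_colon_singleton, smul_eq_mul] at hs
    rw [mul_assoc, mul_comm x s]
    exact N.mul_mem_left c hs
  · intro n hn
    obtain ⟨c, rfl⟩ := Ideal.mem_span_singleton'.mp (hN hn)
    have hc : c ∈ N.colon {x} := by
      rw [Submodule.mem_colon_singleton, smul_eq_mul]
      exact hn
    simpa only [mul_comm x c] using Ideal.mul_mem_mul (Ideal.mem_span_singleton_self x) hc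

/-- **The strict transform of the hypersurface on a chart**: if `x` is a non-zero-divisor and
`x v = u`, then `((u) : x) = (v)` (`u' = u/a` generates `(u S : a) = σᶜ((u), 1)`).
[cite: BierstoneGrigorievMilmanWlodarczyk2011, Lemma 3.6.4 (4)] -/
theorem colon_span_singleton_eq_span_of_mul_eq {x u v : S} (hx : x ∈ nonZeroDivisors S)
    (h : x * v = u) : (Ideal.span {u}).colon {x} = Ideal.span {v} := by
  rw [← colon_span_singleton_mul_eq hx (Ideal.span {v}), Ideal.span_singleton_mul_span_singleton, h]

/-! ## The derivative of a controlled transform -/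

variable {a : R} {δ : Derivation k R R} {D : Derivation k S S}

/-- **The derivative of a controlled transform** ([Wlod] proof of Lemma 3.10.4:
`c'_{α f} = y_m^{-μ+|α|} σ^*(c_{α f})`, derivation form): on a chart `S` over `R` where `a` is a
non-zero-divisor and `D` extends `a·δ`, if `a^{m+1} g' = g` then
`a^m (D g' + (m+1) δ(a) g') = δ(g)` — the controlled transform of `δ g` with multiplicity `m` is
`D g' + (m+1) δ(a) g'`. [cite: Wlodarczyk2005, Lemma 3.10.4 (proof)] -/
theorem pow_mul_transformDeriv_eq (ha : algebraMap R S a ∈ nonZeroDivisors S)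
    (hD : ∀ r : R, D (algebraMap R S r) = algebraMap R S a * algebraMap R S (δ r))
    {g : R} {g' : S} {m : ℕ} (hg : algebraMap R S a ^ (m + 1) * g' = algebraMap R S g) :
    algebraMap R S a ^ m * (D g' + ((m + 1 : ℕ) : S) * algebraMap R S (δ a) * g') =
      algebraMap R S (δ g) := by
  have h : D (algebraMap R S a ^ (m + 1) * g') = D (algebraMap R S g) := by rw [hg]
  rw [Derivation.leibniz, Derivation.leibniz_pow, Nat.add_sub_cancel, hD, hD] at h
  simp only [smul_eq_mul, nsmul_eq_mul] at h
  refine (mul_cancel_left_mem_nonZeroDivisors ha).mp ?_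
  linear_combination h

/-- **`D` is transverse to the strict transform of the hypersurface**: if `a u' = u` on the
chart then `D(u') − δ(u) ∈ (u')` (indeed `D u' = δ(u) − δ(a) u'`).
[cite: Wlodarczyk2005, Lemma 3.10.4 (proof)] -/
theorem apply_transform_sub_mem_span (ha : algebraMap R S a ∈ nonZeroDivisors S)
    (hD : ∀ r : R, D (algebraMap R S r) = algebraMap R S a * algebraMap R S (δ r))
    {u : R} {u' : S} (hu : algebraMap R S a * u' = algebraMap R S u) :
    D u' - algebraMap R S (δ u) ∈ Ideal.span {u'} := by
  have h := pow_mul_transformDeriv_eq (m := 0) ha hD (by rw [zero_add, pow_one, hu])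
  rw [pow_zero, one_mul, zero_add, Nat.cast_one, one_mul] at h
  rw [← h]
  refine Ideal.mem_span_singleton'.mpr ⟨-algebraMap R S (δ a), by ring⟩

/-- Hence **if `δ(u)` is a unit modulo `u`, then `D(u')` is a unit modulo `u'`** (the
transversality hypothesis of `CoefficientIdealRestriction.lean` persists on the chart).
[cite: Wlodarczyk2005, Lemma 3.10.4 (proof)] -/
theorem isUnit_mk_apply_transform (ha : algebraMap R S a ∈ nonZeroDivisors S)
    (hD : ∀ r : R, D (algebraMap R S r) = algebraMap R S a * algebraMap R S (δ r))
    {u : R} {u' : S} (hu : algebraMap R S a * u' = algebraMap R S u)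
    (hunit : IsUnit (Ideal.Quotient.mk (Ideal.span {u}) (δ u))) :
    IsUnit (Ideal.Quotient.mk (Ideal.span {u'}) (D u')) := by
  have hle : Ideal.span {u} ≤ (Ideal.span {u'}).comap (algebraMap R S) := by
    rw [Ideal.span_le, Set.singleton_subset_iff, SetLike.mem_coe, Ideal.mem_comap, ← hu]
    exact Ideal.mul_mem_left _ _ (Ideal.mem_span_singleton_self u')
  have h1 : IsUnit (Ideal.Quotient.mk (Ideal.span {u'}) (algebraMap R S (δ u))) := by
    have := hunit.map (Ideal.quotientMap (Ideal.span {u'}) (algebraMap R S) hle)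
    rwa [Ideal.quotientMap_mk] at this
  have h2 : Ideal.Quotient.mk (Ideal.span {u'}) (D u') =
      Ideal.Quotient.mk (Ideal.span {u'}) (algebraMap R S (δ u)) :=
    (Ideal.Quotient.mk_eq_mk_iff_sub_mem _ _).mpr (apply_transform_sub_mem_span ha hD hu)
  rw [h2]
  exact h1

/-! ## The invariant (T) is stable under multiplication -/

omit [Algebra R S] in
/-- For a derivation `D` and a monotone family of ideals `F_0 ⊆ F_1 ⊆ ⋯`, the condition
"`D^l h ∈ F_l` for all `l ≤ n`" is stable under `h ↦ s h` (Leibniz; induction on `n` with the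
shifted family). [folklore] -/
theorem Derivation.forall_iterate_mul_mem (D : Derivation k S S) :
    ∀ (n : ℕ) (F : ℕ → Ideal S), Monotone F → ∀ (s h : S), (∀ l ≤ n, D^[l] h ∈ F l) →
      ∀ l ≤ n, D^[l] (s * h) ∈ F l := by
  intro n
  induction n with
  | zero =>
    intro F _ s h hh l hl
    obtain rfl := Nat.le_zero.mp hl
    simpa using (F 0).mul_mem_left s (hh 0 le_rfl)
  | succ n ih =>
    intro F hF s h hh l hl
    rcases l with _ | l
    · simpa using (F 0).mul_mem_left s (hh 0 (Nat.zero_le _))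
    · have hl' : l ≤ n := Nat.succ_le_succ_iff.mp hl
      rw [Function.iterate_succ_apply, Derivation.leibniz, smul_eq_mul, smul_eq_mul,
        _root_.iterate_map_add D]
      refine add_mem ?_ ?_
      · refine ih (fun m => F (m + 1)) (fun m m' hmm' => hF (Nat.succ_le_succ hmm')) s (D h)
          (fun m hm => ?_) l hl'
        rw [← Function.iterate_succ_apply D m h]
        exact hh (m + 1) (Nat.succ_le_succ hm)
      · rw [mul_comm h]
        refine ih (fun m => F (m + 1)) (fun m m' hmm' => hF (Nat.succ_le_succ hmm')) (D s) h
          (fun m hm => hF (Nat.le_succ m) (hh m (hm.trans (Nat.le_succ n)))) l hl'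

/-! ## The invariant (T) passes to the chart -/

/-- **The invariant (T) passes to the controlled transforms on a chart** ([Wlod] Lemma 3.10.4,
induction step, derivation form). Let `S` be a chart over `R` for the blow-up along `I ∋ a`
(`a` a non-zero-divisor of `S`, `D` a derivation of `S` extending `a·δ`), `μ ∈ ℕ`, `J ⊆ R` an
ideal and `K_0, K_1, …` ideals with `J S ⊆ (a^μ)` and `K_i S ⊆ (a^{μ-i})` for `i < μ` (BGMW
Lemma 3.2.1 for a centre inside `supp(J, μ)` and `supp(K_i, μ - i)`). If `δ^j f ∈ K_0 + ⋯ + K_j`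
for all `f ∈ J`, `j < μ`, then `D^j f' ∈ K_0' + ⋯ + K_j'` for all `f'` in the controlled
transform `J' = (J S : a^μ)` and `j < μ`, where `K_i' = (K_i S : a^{μ-i})`.
[cite: Wlodarczyk2005, Lemma 3.10.4 (proof)] -/
theorem forall_iterate_transform_mem_iSup_colon (ha : algebraMap R S a ∈ nonZeroDivisors S)
    (hD : ∀ r : R, D (algebraMap R S r) = algebraMap R S a * algebraMap R S (δ r))
    {μ : ℕ} (K : ℕ → Ideal R)
    (hK : ∀ i < μ, (K i).map (algebraMap R S) ≤ Ideal.span {algebraMap R S a ^ (μ - i)})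
    {J : Ideal R} (hJ : J.map (algebraMap R S) ≤ Ideal.span {algebraMap R S a ^ μ})
    (hδ : ∀ f ∈ J, ∀ j < μ, δ^[j] f ∈ ⨆ (i : ℕ) (_ : i ≤ j), K i) :
    ∀ f' ∈ (J.map (algebraMap R S)).colon {algebraMap R S a ^ μ}, ∀ j < μ,
      D^[j] f' ∈ ⨆ (i : ℕ) (_ : i ≤ j),
        ((K i).map (algebraMap R S)).colon {algebraMap R S a ^ (μ - i)} := by
  -- notation: `ι : R → S`, `b = ι a`, `K'_i = (K_i S : b^{μ-i})`, `F'_j = K'_0 + ⋯ + K'_j`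
  set ι : R →+* S := algebraMap R S with hι
  set b : S := ι a with hb
  set K' : ℕ → Ideal S := fun i => ((K i).map ι).colon {b ^ (μ - i)} with hK'
  set F' : ℕ → Ideal S := fun j => ⨆ (i : ℕ) (_ : i ≤ j), K' i with hF'
  have hbnz : ∀ n : ℕ, b ^ n ∈ nonZeroDivisors S := fun n => pow_mem ha n
  have hF'mono : Monotone F' := fun j j' hjj' => biSup_mono fun i hi => hi.trans hjj'
  have hK'F' : ∀ {i j : ℕ}, i ≤ j → K' i ≤ F' j := fun {i j} hij => le_biSup K' hij
  -- the goal in this notation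
  suffices H : ∀ f' ∈ (J.map ι).colon {b ^ μ}, ∀ j < μ, D^[j] f' ∈ F' j from H
  -- `K_l S ⊆ b^{μ-i} F'_i` for `l ≤ i < μ`
  have hKle : ∀ {l i : ℕ}, l ≤ i → i < μ → (K l).map ι ≤ Ideal.span {b ^ (μ - i)} * F' i := by
    intro l i hli hiμ
    have hKl : (K l).map ι ≤ Ideal.span {b ^ (μ - l)} := hK l (by omega)
    calc (K l).map ι = Ideal.span {b ^ (μ - l)} * K' l :=
          (Ideal.span_singleton_mul_colon_eq_of_le hKl).symm
      _ = Ideal.span {b ^ (μ - i)} * (Ideal.span {b ^ (i - l)} * K' l) := by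
          rw [← mul_assoc, Ideal.span_singleton_mul_span_singleton, ← pow_add,
            show μ - i + (i - l) = μ - l by omega]
      _ ≤ Ideal.span {b ^ (μ - i)} * F' i :=
          Ideal.mul_mono_right (Ideal.mul_le_left.trans (hK'F' hli))
  -- Step 1: generators `g' = g / a^μ`, `g ∈ J`
  have hgen : ∀ g ∈ J, ∀ g' : S, b ^ μ * g' = ι g → ∀ j < μ, D^[j] g' ∈ F' j := by
    intro g hg g' hgg'
    -- the transforms `t_i = δ^i(g) / a^{μ-i} ∈ F'_i`
    have hex : ∀ i : ℕ, ∃ t : S, i < μ → (t ∈ F' i ∧ b ^ (μ - i) * t = ι (δ^[i] g)) := by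
      intro i
      by_cases hi : i < μ
      · have hmem : ι (δ^[i] g) ∈ Ideal.span {b ^ (μ - i)} * F' i := by
          have h1 : (⨆ (l : ℕ) (_ : l ≤ i), K l).map ι ≤ Ideal.span {b ^ (μ - i)} * F' i := by
            rw [Ideal.map_iSup]
            refine iSup_le fun l => ?_
            rw [Ideal.map_iSup]
            exact iSup_le fun hl => hKle hl hi
          exact h1 (Ideal.mem_map_of_mem _ (hδ g hg i hi))
        obtain ⟨t, ht, hbt⟩ := Ideal.mem_span_singleton_mul.mp hmem
        exact ⟨t, fun _ => ⟨ht, hbt⟩⟩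
      · exact ⟨0, fun h => absurd h hi⟩
    choose t ht using hex
    -- `D t_i = t_{i+1} - (μ - i) δ(a) t_i`
    have hrel : ∀ i : ℕ, i + 1 < μ →
        D (t i) = t (i + 1) - ((μ - i : ℕ) : S) * ι (δ a) * t i := by
      intro i hi
      obtain ⟨m, hm⟩ : ∃ m : ℕ, μ - (i + 1) = m := ⟨_, rfl⟩
      have hmi : μ - i = m + 1 := by omega
      have h1 : b ^ (m + 1) * t i = ι (δ^[i] g) := by rw [← hmi]; exact (ht i (by omega)).2
      have h2 := pow_mul_transformDeriv_eq (m := m) ha hD (hb ▸ hι ▸ h1)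
      rw [← hb, ← hι, ← Function.iterate_succ_apply' δ i g, ← (ht (i + 1) hi).2, hm] at h2
      have h3 := (mul_cancel_left_mem_nonZeroDivisors (hbnz m)).mp h2
      rw [hmi, ← h3]
      ring
    -- `D^j t_0 ∈ S t_0 + ⋯ + S t_j`
    have hspan : ∀ j < μ, D^[j] (t 0) ∈ Ideal.span (t '' Set.Iic j) := by
      intro j
      induction j with
      | zero =>
        intro _
        exact Ideal.subset_span ⟨0, Set.mem_Iic.mpr le_rfl, rfl⟩
      | succ j ih =>
        intro hj
        rw [Function.iterate_succ_apply']
        have hsub : Ideal.span (t '' Set.Iic j) ≤ Ideal.span (t '' Set.Iic (j + 1)) :=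
          Ideal.span_mono (Set.image_mono (Set.Iic_subset_Iic.mpr (Nat.le_succ j)))
        refine Submodule.span_induction (p := fun x _ => D x ∈ Ideal.span (t '' Set.Iic (j + 1)))
          ?_ ?_ ?_ ?_ (ih (Nat.lt_of_succ_lt hj))
        · rintro _ ⟨i, hi, rfl⟩
          rw [Set.mem_Iic] at hi
          rw [hrel i (by omega)]
          refine sub_mem (Ideal.subset_span ⟨i + 1, Set.mem_Iic.mpr (by omega), rfl⟩)
            (Ideal.mul_mem_left _ _ (Ideal.subset_span ⟨i, Set.mem_Iic.mpr (by omega), rfl⟩))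
        · rw [map_zero]
          exact zero_mem _
        · intro x y _ _ hx hy
          rw [map_add]
          exact add_mem hx hy
        · intro s x hx hDx
          rw [smul_eq_mul, Derivation.leibniz, smul_eq_mul, smul_eq_mul]
          exact add_mem (Ideal.mul_mem_left _ _ hDx) (Ideal.mul_mem_right _ _ (hsub hx))
    -- conclude for the generator
    intro j hj
    have hg't : g' = t 0 := by
      refine (mul_cancel_left_mem_nonZeroDivisors (hbnz μ)).mp ?_
      have h0 := (ht 0 (by omega)).2
      rw [Nat.sub_zero, Function.iterate_zero_apply] at h0
      rw [hgg', h0]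
    rw [hg't]
    refine (Ideal.span_le.mpr ?_) (hspan j hj)
    rintro _ ⟨i, hi, rfl⟩
    rw [Set.mem_Iic] at hi
    exact hF'mono hi (ht i (by omega)).1
  -- Step 2: `J' = (J S : a^μ)` is generated by the `g / a^μ`
  intro f' hf' j hj
  have hG : J.map ι ≤ Ideal.span {b ^ μ} * Ideal.span {g' : S | ∃ g ∈ J, b ^ μ * g' = ι g} := by
    rw [Ideal.map, Ideal.span_le]
    rintro _ ⟨g, hg, rfl⟩
    have hgb : ι g ∈ Ideal.span {b ^ μ} := hJ (Ideal.mem_map_of_mem _ hg)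
    obtain ⟨g', hgg'⟩ := Ideal.mem_span_singleton'.mp hgb
    have hgg'' : b ^ μ * g' = ι g := by rw [mul_comm, hgg']
    have hmemG : g' ∈ {g' : S | ∃ g ∈ J, b ^ μ * g' = ι g} := ⟨g, hg, hgg''⟩
    have hmem : b ^ μ * g' ∈
        Ideal.span {b ^ μ} * Ideal.span {g' : S | ∃ g ∈ J, b ^ μ * g' = ι g} :=
      Ideal.mul_mem_mul (Ideal.mem_span_singleton_self (b ^ μ)) (Ideal.subset_span hmemG)
    rw [hgg''] at hmem
    exact hmem
  have hf'' : f' ∈ Ideal.span {g' : S | ∃ g ∈ J, b ^ μ * g' = ι g} := by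
    rw [← colon_span_singleton_mul_eq (hbnz μ) (Ideal.span {g' : S | ∃ g ∈ J, b ^ μ * g' = ι g})]
    rw [Submodule.mem_colon_singleton] at hf' ⊢
    exact hG hf'
  -- Step 3: the condition is an ideal condition
  revert j
  refine Submodule.span_induction (p := fun x _ => ∀ j < μ, D^[j] x ∈ F' j) ?_ ?_ ?_ ?_ hf''
  · rintro x ⟨g, hg, hx⟩
    exact hgen g hg x hx
  · have hD0 : ∀ n : ℕ, D^[n] (0 : S) = 0 := fun n => by
      induction n with
      | zero => rfl
      | succ n ih => rw [Function.iterate_succ_apply', ih, map_zero]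
    intro j _
    rw [hD0]
    exact zero_mem _
  · intro x y _ _ hx hy j hj
    rw [_root_.iterate_map_add D]
    exact add_mem (hx j hj) (hy j hj)
  · intro s x _ hx j hj
    rcases Nat.eq_zero_or_pos μ with hμ | hμ
    · omega
    · exact Derivation.forall_iterate_mul_mem D (μ - 1) F' hF'mono s x
        (fun l hl => hx l (by omega)) j (by omega)

end Chart

end Literature.AlgebraicGeometry.Resolution

end
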